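import Mathlib
import Summits.NavierStokesRegularity.NavierStokesRegularity.Theorems.SubcriticalEnvelopeForwardSourceTailEnvelopeSideBranch
import Summits.NavierStokesRegularity.NavierStokesRegularity.Theorems.SubcriticalEnvelopeForwardSourceTailEnvelopeOrthant
import Summits.NavierStokesRegularity.NavierStokesRegularity.Theorems.SubOnsagerCeilingOrthantTailCeiling.Negative.OrthantTailCeilingFalseOfSideBranchEscape
import HarnessLib

/-!
# `SubcriticalEnvelope.ForwardSourceTailEnvelope` (stmt-NavierStokesRegularity-26373) — negative
lemma MODULO anomalous escape of the side-branch table at small scale ratio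
(`SideBranchEscapeSmallRatio`, built from the cluster's shared hypothesis `SideBranchEscapeAt` of
`Theorems/SubOnsagerCeilingOrthantTailCeiling/Negative/OrthantTailCeilingFalseOfSideBranchEscape.lean`,
seat ns-soc-p2)

`forwardSourceTailEnvelope_imp_totalEnvelope_sideBranch` (sibling `…SideBranch.lean`): the crux A⁺
AS TYPED implies, below its own threshold `εs(17)`, a `ν`-uniform WINDOW-WISE subcritical envelope
`Σ_{k=n..N} Σ_i ½X_{i,k}(t)² ≤ C(T)(1+ε₀)^{-(1+η)n}` of the TOTAL tail energy of every honest viscous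
solution of the side-branch dead-end lattice `α_SB = sideBranchTable`, from every one-shell datum.
A window-wise envelope with `1 + η > 1` is in particular a per-shell ceiling with `θ = (1+η)/2 > 1/2`
on `[0, T₀]`, and ns-soc-p2's CEILING ⇒ NO ESCAPE mechanism (`sideBranch_noEscape_abstract`,
`sideBranch_noEscape_rate`: the dead-end pocket meters the conveyor, so under a sub-Onsager ceiling a
deep block `0..K` keeps all but `Φ₁(1+ε₀)^{-(θ-1/2)K} + 2ν_K E_max T₀` of the energy) only ever uses
the ceiling along ONE solution on ONE window `[0,s] ⊆ [0,T₀]`.  Hence: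

* `sideBranch_not_escape_of_windowEnvelope` — the window-wise total-energy envelope at scale ratio
  `1+ε₀` (VERBATIM the conclusion of `forwardSourceTailEnvelope_imp_totalEnvelope_sideBranch` at
  `ε₀`, i.e. the A‴ body on `α_SB`) excludes `SideBranchEscapeAt ε₀` (proof = ns-soc-p2's
  `sideBranch_not_escape_of_shellCeiling` with the global ceiling replaced by the window constant
  `C(T₀)`; no sign condition is needed);
* `SideBranchEscapeSmallRatio` (a `Prop`, NOTHING asserted): anomalous escape of `α_SB` at
  ARBITRARILY SMALL scale ratio, `∀ ε̄ ∈ (0,1] ∃ ε₀ ∈ (0,ε̄], SideBranchEscapeAt ε₀` — the form a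
  refutation of the small-ratio crux A⁺ needs (A⁺ chooses `εs` first); numerically the escape is
  seen at every tested ratio `ε₀ = 1/4 … 1/64` (`REFUTATION-EVIDENCE.md` §5, kit j302483), the
  limit `ε₀ → 0` is extrapolation; it implies ns-soc-p2's `SideBranchEscape`;
* **`forwardSourceTailEnvelope_false_of_sideBranchEscapeSmallRatio :
    SideBranchEscapeSmallRatio → ¬ForwardSourceTailEnvelope`** — so ONE construction
  (`SideBranchEscapeAt ε₀` at arbitrarily small `ε₀`) refutes 25507 (by `SideBranchEscape`), 26608
  (through ns-ow-p1's `ForwardTailCeiling → CeilingAt 10 ε₀ sideBranchTable`) and 26373 as typed;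
* `viscousTailEnvelope_false_of_sideBranchEscapeSmallRatio` — the same for the aside A‴ (26128).

HONEST FRAMING: conditional refutations about Tao-type MODEL lattice ODEs (route
SubcriticalEnvelope, rung TL-M2Break); the hypothesis is a numerics-backed CONSTRUCTION TARGET, not
a theorem and not a published fact; nothing is refuted unconditionally; nothing here is a statement
about the Navier–Stokes equations, and NS regularity is NOT advanced.
-/

noncomputable section

-- the sub-problem namespace `NavierStokesRegularity.NavierStokesRegularity` is the tree's layout (D-0017)
set_option linter.dupNamespace false

namespace Summit.NavierStokesRegularity.NavierStokesRegularity.Theorems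

open Set Filter MeasureTheory intervalIntegral
open scoped Topology
open Literature.Analysis.FluidPDE.TaoCascade
open Summit.NavierStokesRegularity.NavierStokesRegularity.Theorems.SubOnsagerCeiling
open Summit.NavierStokesRegularity.NavierStokesRegularity.Theses

/-! ## §1 WINDOW ENVELOPE ⇒ NO ESCAPE -/

set_option maxHeartbeats 400000 in
/-- **A window-wise total-energy envelope on `α_SB` excludes anomalous escape at the same scale
ratio.**  Hypothesis = VERBATIM the conclusion of `forwardSourceTailEnvelope_imp_totalEnvelope_sideBranch`
at `ε₀` (for every one-shell datum a margin `η > 0` and window constants `C(T)`, uniform in `ν`,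
bounding the tail sums of every honest `ν`-viscous `α_SB`-solution on `[0,s] ⊆ [0,T]`).  Proof:
ns-soc-p2's `sideBranch_not_escape_of_shellCeiling` run with `θ = (1+η)/2 > 1/2` and the window
constant `C(T₀)` of the escape datum (pocket meter + side meter + block budget:
`sideBranch_noEscape_abstract`, `sideBranch_noEscape_rate`).  MODEL lattice only. [this file] -/
theorem sideBranch_not_escape_of_windowEnvelope {ε₀ : ℝ} (hε : 0 < ε₀)
    (henv : ∀ X₀ : Fin 4 → ℝ, ∃ η : ℝ, 0 < η ∧
      ∀ T : ℝ, 0 < T → ∃ C : ℝ, ∀ ν : ℝ, 0 < ν → ∀ s ∈ Set.Ioc (0 : ℝ) T,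
      ∀ X : Fin 4 → ℤ → ℝ → ℝ,
      (∀ i k, X i k 0 = if k = 0 then X₀ i else 0) →
      (∀ i k, k < 0 → ∀ t, X i k t = 0) →
      (∃ M : ℝ, ∀ (t : ℝ) (i : Fin 4) (k : ℤ), (1 + (1 + ε₀) ^ ((10 : ℝ) * k)) * |X i k t| ≤ M) →
      (∀ i k, Continuous (X i k)) →
      (∀ i k, ∀ t ∈ Set.Icc (0 : ℝ) s, HasDerivWithinAt (X i k)
        (quadTerm ε₀ sideBranchTable X i k t - ν * (1 + ε₀) ^ ((2 : ℝ) * k) * X i k t)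
        (Set.Icc 0 s) t) →
      ∀ n N : ℕ, n ≤ N → ∀ t ∈ Set.Icc (0 : ℝ) s,
        ∑ k ∈ Finset.Icc n N, ∑ i, (1 / 2) * X i (k : ℤ) t ^ 2 ≤
          C * (1 + ε₀) ^ (-((1 + η) * (n : ℝ)))) :
    ¬ SideBranchEscapeAt ε₀ := by
  rintro ⟨ρ, hρ, T₀, hT₀, X₀, hE₀, hfam⟩
  have hb : (0 : ℝ) < 1 + ε₀ := by linarith
  have hb1 : (1 : ℝ) < 1 + ε₀ := by linarith
  -- the window envelope of the escape datum on `[0, T₀]`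
  obtain ⟨η, hη, HT⟩ := henv X₀
  obtain ⟨C₀, hC₀⟩ := HT T₀ hT₀
  set θ : ℝ := (1 + η) / 2 with hθdef
  have hθ : 1 / 2 < θ := by rw [hθdef]; linarith
  set E₀ : ℝ := ∑ i : Fin 4, (1 / 2 : ℝ) * X₀ i ^ 2 with hE₀def
  set C : ℝ := max C₀ 0 / E₀ with hCdef
  have hC : 0 ≤ C := div_nonneg (le_max_right _ _) hE₀.le
  have hCE : C * E₀ = max C₀ 0 := by rw [hCdef]; exact div_mul_cancel₀ _ hE₀.ne'
  have hexp : ∀ k : ℕ, (1 + ε₀) ^ (-((1 + η) * (k : ℝ))) = (1 + ε₀) ^ (-(2 * θ * (k : ℝ))) := by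
    intro k; congr 1; rw [hθdef]; ring
  -- per-shell ceiling along every honest solution on a window inside `[0, T₀]`
  have hceil : ∀ ν : ℝ, 0 < ν → ∀ s : ℝ, 0 < s → s ≤ T₀ → ∀ X : Fin 4 → ℤ → ℝ → ℝ,
      (∀ (i : Fin 4) (k : ℤ), X i k 0 = if k = 0 then X₀ i else 0) →
      (∀ (i : Fin 4) (k : ℤ), k < 0 → ∀ t : ℝ, X i k t = 0) →
      (∃ M : ℝ, ∀ (t : ℝ) (i : Fin 4) (k : ℤ), (1 + (1 + ε₀) ^ ((10 : ℝ) * k)) * |X i k t| ≤ M) →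
      (∀ (i : Fin 4) (k : ℤ), Continuous (X i k)) →
      (∀ (i : Fin 4) (k : ℤ), ∀ t ∈ Set.Icc (0 : ℝ) s, HasDerivWithinAt (X i k)
        (quadTerm ε₀ sideBranchTable X i k t - ν * (1 + ε₀) ^ ((2 : ℝ) * k) * X i k t)
        (Set.Icc (0 : ℝ) s) t) →
      ∀ k : ℕ, ∀ t ∈ Set.Icc (0 : ℝ) s, ∑ i : Fin 4, (1 / 2 : ℝ) * X i (k : ℤ) t ^ 2 ≤
        C * E₀ * (1 + ε₀) ^ (-(2 * θ * (k : ℝ))) := by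
    intro ν hν s hs hsT X hinit hlow hbd hcont hder k t ht
    have h := hC₀ ν hν s ⟨hs, hsT⟩ X hinit hlow hbd hcont hder k k le_rfl t ht
    simp only [Finset.Icc_self, Finset.sum_singleton] at h
    rw [hCE, ← hexp k]
    exact h.trans (mul_le_mul_of_nonneg_right (le_max_left _ _) (Real.rpow_nonneg hb.le _))
  -- from here on: ns-soc-p2's CEILING ⇒ NO ESCAPE argument, verbatim with the window constant
  set A : ℝ := Real.sqrt (2 * C * E₀) with hAdef
  have hA0 : 0 ≤ A := Real.sqrt_nonneg _
  set Φ₁ : ℝ := (5 + T₀ / 2 + 25 * Real.exp 1 / 2 + Real.exp 1) * A ^ 2 +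
    5 * Real.exp 1 / 2 * A ^ 3 + 5 * T₀ / 2 * A with hΦ₁def
  set q : ℝ := (1 + ε₀) ^ (-(θ - 1 / 2)) with hqdef
  have hq0 : 0 ≤ q := Real.rpow_nonneg hb.le _
  have hq1 : q < 1 := Real.rpow_lt_one_of_one_lt_of_neg hb1 (by linarith)
  have hρE : 0 < ρ * E₀ / 2 := by positivity
  have htend : Tendsto (fun K : ℕ => Φ₁ * q ^ K) atTop (𝓝 (Φ₁ * 0)) :=
    (tendsto_pow_atTop_nhds_zero_of_lt_one hq0 hq1).const_mul Φ₁
  rw [mul_zero] at htend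
  obtain ⟨K, hKsmall, hK1⟩ := ((htend.eventually (gt_mem_nhds hρE)).and
    (eventually_ge_atTop 1)).exists
  have hqK : (1 + ε₀) ^ (-((θ - 1 / 2) * (K : ℝ))) = q ^ K := by
    rw [show -((θ - 1 / 2) * (K : ℝ)) = (-(θ - 1 / 2)) * (K : ℝ) by ring,
      Real.rpow_mul_natCast hb.le]
  set Emax : ℝ := C * E₀ * ((K : ℝ) + 1) with hEmaxdef
  have hEmax0 : 0 ≤ Emax := by positivity
  set D : ℝ := 8 * (1 + ε₀) ^ ((2 : ℝ) * (K : ℝ)) * Emax * T₀ + 1 with hDdef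
  have hD0 : 0 < D := by positivity
  set ν₀ : ℝ := min 1 (min (1 / ((1 + ε₀) ^ ((2 : ℝ) * ((K : ℝ) + 1)) * T₀)) (ρ * E₀ / D))
    with hν₀def
  have hν₀ : 0 < ν₀ := lt_min one_pos (lt_min (by positivity) (by positivity))
  obtain ⟨ν, hν, hνle, s, hs, hsT, X, hinit, hlow, hbd, hcont, hder, hdef⟩ := hfam K ν₀ hν₀
  have hν1 : ν ≤ 1 := hνle.trans (min_le_left _ _)
  have hν2 : ν ≤ 1 / ((1 + ε₀) ^ ((2 : ℝ) * ((K : ℝ) + 1)) * T₀) :=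
    hνle.trans ((min_le_right _ _).trans (min_le_left _ _))
  have hν3 : ν ≤ ρ * E₀ / D := hνle.trans ((min_le_right _ _).trans (min_le_right _ _))
  have hshell : ∀ u ∈ Icc (0 : ℝ) s, ∀ k : ℕ, ∑ i : Fin 4, (1 / 2 : ℝ) * X i (k : ℤ) u ^ 2 ≤
      C * E₀ * (1 + ε₀) ^ (-(2 * θ * (k : ℝ))) :=
    fun u hu k => hceil ν hν s hs hsT X hinit hlow hbd hcont hder k u hu
  have hE₀0 : 0 ≤ E₀ := hE₀.le
  have habs : ∀ u ∈ Icc (0 : ℝ) s, ∀ (k : ℕ) (i : Fin 4),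
      |X i (k : ℤ) u| ≤ A * (1 + ε₀) ^ (-(θ * (k : ℝ))) :=
    fun u hu k i => sideBranch_abs_le_of_shellCeiling hε hC hE₀0 (hshell u hu k) i
  have hcast : ((K + 1 : ℕ) : ℤ) = (K : ℤ) + 1 := by push_cast; ring
  have hcastR : ((K + 1 : ℕ) : ℝ) = (K : ℝ) + 1 := by push_cast; ring
  have ha₀ : ∀ u ∈ Icc (0 : ℝ) s, |X 1 (K : ℤ) u| ≤ A * (1 + ε₀) ^ (-(θ * (K : ℝ))) :=
    fun u hu => habs u hu K 1
  have ha₁x : ∀ u ∈ Icc (0 : ℝ) s, |X 0 ((K : ℤ) + 1) u| ≤ A * (1 + ε₀) ^ (-(θ * ((K : ℝ) + 1))) :=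
    fun u hu => by rw [← hcast, ← hcastR]; exact habs u hu (K + 1) 0
  have ha₁z : ∀ u ∈ Icc (0 : ℝ) s, |X 2 ((K : ℤ) + 1) u| ≤ A * (1 + ε₀) ^ (-(θ * ((K : ℝ) + 1))) :=
    fun u hu => by rw [← hcast, ← hcastR]; exact habs u hu (K + 1) 2
  have hE : ∀ u ∈ Icc (0 : ℝ) s, ∑ k ∈ Finset.range (K + 1), ∑ i : Fin 4,
      (1 / 2 : ℝ) * X i (k : ℤ) u ^ 2 ≤ Emax := by
    intro u hu
    calc ∑ k ∈ Finset.range (K + 1), ∑ i : Fin 4, (1 / 2 : ℝ) * X i (k : ℤ) u ^ 2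
        ≤ ∑ k ∈ Finset.range (K + 1), C * E₀ := Finset.sum_le_sum fun k _ =>
          (hshell u hu k).trans (mul_le_of_le_one_right (by positivity)
            (Real.rpow_le_one_of_one_le_of_nonpos hb1.le (by
              have : (0 : ℝ) ≤ k := Nat.cast_nonneg k
              nlinarith)))
      _ = Emax := by simp [hEmaxdef, Finset.sum_const, Finset.card_range]; ring
  have h10 : X 1 (K : ℤ) 0 = 0 := by rw [hinit, if_neg (by exact_mod_cast (by omega : K ≠ 0))]
  have h20 : X 2 ((K : ℤ) + 1) 0 = 0 := by rw [hinit, if_neg (by omega)]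
  have hss : s ∈ Icc (0 : ℝ) s := ⟨hs.le, le_rfl⟩
  have hP0 : 0 < (1 + ε₀) ^ ((2 : ℝ) * ((K : ℝ) + 1)) * T₀ := by positivity
  have hνt : ν * (1 + ε₀) ^ ((2 : ℝ) * ((K : ℝ) + 1)) * s ≤ 1 := by
    calc ν * (1 + ε₀) ^ ((2 : ℝ) * ((K : ℝ) + 1)) * s
        ≤ ν * (1 + ε₀) ^ ((2 : ℝ) * ((K : ℝ) + 1)) * T₀ := by gcongr
      _ ≤ 1 / ((1 + ε₀) ^ ((2 : ℝ) * ((K : ℝ) + 1)) * T₀) *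
            (1 + ε₀) ^ ((2 : ℝ) * ((K : ℝ) + 1)) * T₀ := by gcongr
      _ = 1 := by field_simp
  have hδ : (0 : ℝ) < (1 + ε₀) ^ (-((1 + θ) * (K : ℝ))) := Real.rpow_pos_of_pos hb _
  have hmain := sideBranch_noEscape_abstract hε hν.le hlow hcont hder K h10 h20 hδ hss ha₀ ha₁x
    ha₁z hE hνt
  have hrate := sideBranch_noEscape_rate hε hν1 hθ hA0 hs.le hsT K
  dsimp only at hrate
  rw [hqK, ← hΦ₁def] at hrate
  have hdiss : 2 * (ν * (1 + ε₀) ^ ((2 : ℝ) * (K : ℝ))) * Emax * s ≤ ρ * E₀ / 4 := by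
    have h1 : 2 * (ν * (1 + ε₀) ^ ((2 : ℝ) * (K : ℝ))) * Emax * s ≤
        2 * ((ρ * E₀ / D) * (1 + ε₀) ^ ((2 : ℝ) * (K : ℝ))) * Emax * T₀ := by gcongr
    have h2 : 2 * ((ρ * E₀ / D) * (1 + ε₀) ^ ((2 : ℝ) * (K : ℝ))) * Emax * T₀ =
        ρ * E₀ / 4 * ((8 * (1 + ε₀) ^ ((2 : ℝ) * (K : ℝ)) * Emax * T₀) / D) := by
      field_simp
      ring
    have h3 : (8 * (1 + ε₀) ^ ((2 : ℝ) * (K : ℝ)) * Emax * T₀) / D ≤ 1 := by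
      rw [div_le_one hD0, hDdef]
      linarith
    have h4 : ρ * E₀ / 4 * ((8 * (1 + ε₀) ^ ((2 : ℝ) * (K : ℝ)) * Emax * T₀) / D) ≤ ρ * E₀ / 4 :=
      mul_le_of_le_one_right (by positivity) h3
    linarith
  have hB0 : (∑ k ∈ Finset.range (K + 1), ∑ i : Fin 4, (1 / 2 : ℝ) * X i (k : ℤ) 0 ^ 2) = E₀ := by
    rw [Finset.sum_range_succ']
    have h1 : ∀ k : ℕ, (∑ i : Fin 4, (1 / 2 : ℝ) * X i ((k + 1 : ℕ) : ℤ) 0 ^ 2) = 0 := fun k =>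
      Finset.sum_eq_zero fun i _ => by
        rw [hinit, if_neg (by push_cast; omega)]
        ring
    simp only [h1, Finset.sum_const_zero, zero_add]
    refine Finset.sum_congr rfl fun i _ => ?_
    rw [hinit, if_pos (by simp)]
  rw [hB0] at hmain
  have hρE₀ : 0 < ρ * E₀ := mul_pos hρ hE₀
  linarith

/-! ## §2 The construction hypothesis at small scale ratio and the conditional refutations -/

/-- **`SideBranchEscapeSmallRatio` — anomalous escape of the side-branch table at ARBITRARILY
SMALL scale ratio**: for every threshold `ε̄ ∈ (0,1]` some `ε₀ ∈ (0, ε̄]` carries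
`SideBranchEscapeAt ε₀` (ns-soc-p2's construction hypothesis: a fixed fraction `ρE₀` of a one-shell
datum's energy leaves every block of shells `0..K` of the `ν`-viscous `α_SB` lattice within a fixed
time `T₀`, at arbitrarily small `ν`).  Numerically the escape is seen at every tested ratio
`ε₀ = 1/4 … 1/64` (`Cruxes/OrthantTailCeiling/REFUTATION-EVIDENCE.md` §5, kit j302483); the limit
`ε₀ → 0` is extrapolation.  A `Prop`; NOTHING is asserted — it is the hypothesis of
`forwardSourceTailEnvelope_false_of_sideBranchEscapeSmallRatio`, a CONSTRUCTION TARGET and not a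
published fact (vocabulary: Tao 2016 §4 (4.5), (4.8), the viscous equation before Thm. 4.2).
[this file] -/
def SideBranchEscapeSmallRatio : Prop :=
  ∀ εbar : ℝ, 0 < εbar → εbar ≤ 1 → ∃ ε₀ : ℝ, 0 < ε₀ ∧ ε₀ ≤ εbar ∧ SideBranchEscapeAt ε₀

/-- `SideBranchEscapeSmallRatio` implies ns-soc-p2's `SideBranchEscape` (escape at SOME ratio
`≤ 1`), hence everything that hypothesis refutes (`OrthantTailCeiling`, the line «shell-barrier»).
[this file] -/
theorem sideBranchEscape_of_smallRatio (hH : SideBranchEscapeSmallRatio) : SideBranchEscape := by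
  obtain ⟨ε₀, hε₀, hle, h⟩ := hH 1 one_pos le_rfl
  exact ⟨ε₀, hε₀, hle, h⟩

/-- **Negative lemma (conditional refutation of the crux AS TYPED).**
`SideBranchEscapeSmallRatio → ¬ForwardSourceTailEnvelope`: A⁺ gives a threshold `εs` and, through
the twin embedding (`forwardSourceTailEnvelope_imp_totalEnvelope_sideBranch`), the window-wise
total-energy envelope on `α_SB` at every `ε₀ ≤ εs`; the hypothesis supplies anomalous escape at some
`ε₀ ≤ min εs 1`, contradicting `sideBranch_not_escape_of_windowEnvelope`.  MODEL lattice only;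
conditional; settles nothing by itself. [this file] -/
theorem forwardSourceTailEnvelope_false_of_sideBranchEscapeSmallRatio
    (hH : SideBranchEscapeSmallRatio) : ¬ SubcriticalEnvelope.ForwardSourceTailEnvelope := by
  intro hA
  obtain ⟨εs, hεs, Henv⟩ := forwardSourceTailEnvelope_imp_totalEnvelope_sideBranch hA
  obtain ⟨ε₀, hε₀, hle, hEsc⟩ := hH (min εs 1) (lt_min hεs one_pos) (min_le_right _ _)
  exact sideBranch_not_escape_of_windowEnvelope hε₀ (Henv ε₀ hε₀ (hle.trans (min_le_left _ _))) hEsc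

/-- **The same conditional refutation for the aside A‴ = `ViscousTailEnvelope` (stmt-26128)**,
through A‴ ⇒ A⁺ (`forwardSourceTailEnvelope_of_viscousTailEnvelope`).  MODEL lattice only;
conditional. [this file] -/
theorem viscousTailEnvelope_false_of_sideBranchEscapeSmallRatio (hH : SideBranchEscapeSmallRatio) :
    ¬ SubcriticalEnvelope.ViscousTailEnvelope :=
  fun hA => forwardSourceTailEnvelope_false_of_sideBranchEscapeSmallRatio hH
    (forwardSourceTailEnvelope_of_viscousTailEnvelope hA)

end Summit.NavierStokesRegularity.NavierStokesRegularity.Theorems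

end
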